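import Literature.Computability.AlgebraicComplexity.MS21DenseOrbitsHittingSets
import Literature.Computability.AlgebraicComplexity.CKSV22GeneralABPLowerBound
import HarnessLib

/-!
# Dutta–Dwivedi–Saxena 2021: the border of bounded-top-fan-in depth-3 circuits (statements)

Typed literature (cell `val-lit`, cross-ladder typing row X2-DDS21; desk lead-np). P. Dutta,
P. Dwivedi, N. Saxena, *Demystifying the border of depth-3 algebraic circuits*, FOCS 2021
[DuttaDwivediSaxena2022]. NUMBERING: this file follows the held FULL VERSION of the paper
(`paper:galaxy-pdf-7641649743695546420`, 60 text chunks `pNNNN.txt`, SIAM-style with printed line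
numbers `Lnnn`; its §1 Thms 1.1–1.3 are the informal forms of Thm 3.2, Thm 4.1, Thm 4.4); every
docstring gives `chunk:line` of that text and the printed line numbers.

Honest framing: STATEMENTS ONLY — cite-tagged `def … : Prop` named facts for published, refereed
theorems the tree does not prove (D-0014), plus definitions with bodies and a few proved API lemmas.
Typed ≠ proved. Nothing here bears on VP versus VNP, which is NOT proved; "de-bordering" bounded
depth-3 circuits is a KNOWN result (bears on the de-bordering rung of the `val-lit` gap ledger, §V4 N5).

## Vocabulary (reused, not restated)

* `MS2021.IsSPS s d f` (`MS21DenseOrbitsHittingSets.lean`): `f = ∑_{i<s} ∏_{j<d} ℓ_{ij}` with affine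
  `ℓ_{ij}` — a `Σ^{[s]}Π^{[d]}Σ` circuit (DDS §1, p0006:L1, "`Σ^{[k]}Π^{[d]}Σ` … compute polynomials of
  the form `f = ∑_{i∈[k]} ∏_{j∈[d]} ℓ_{ij}` where `ℓ_{ij}` are linear polynomials").
* `MS2021.IsEpsApprox f g`: `g ∈ F[ε][x] ⊆ F(ε)[x]` (`F(ε) = RatFunc F`) with `g = f + ε·Q`,
  `Q ∈ F[ε][x]` — exactly DDS Def. 2.1's "`g(x,ε) := f(x) + ε·Q(x,ε)`" (coefficientwise: every
  coefficient of `g` is a polynomial in `ε` with constant term the coefficient of `f`).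
* `HittingSets.IsHittingSetFor H 𝒞` (`GKSS19HardnessToHittingSets.lean`): DDS §2.1 L464–466 "A set
  of points `H ⊆ F^n` is called a hitting set for a class `𝒞` of `n`-variate polynomials if for any
  nonzero polynomial `f ∈ 𝒞`, there exists a point in `H` where `f` evaluates to a nonzero value."
* `LayeredABPDegComputes` (`CKSV22GeneralABPLowerBound.lean`): layered ABPs with a vertex budget and
  a degree bound on edge labels; DDS's ABPs (Def. 2.5: UNIVARIATE edge labels) are the special case
  `DDS2021.UABPComputes`, bridged by `UABPComputes.layeredABPDegComputes`.

## What is typed (decl ↦ printed item)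

* Def. 2.1 (approximative closure `C̄` of a class over `F(ε)`) ↦ `DDS2021.border`.
* Def. 2.5 (ABP, size) ↦ `DDS2021.UABPComputes` (+ `mono`, bridge to CKSV).
* The syntactic classes: `DDS2021.spsClass` (`Σ^{[k]}Π^{[d]}Σ`), `swsClass` (`Σ∧Σ`, §2.3),
  `spswClass` (`Σ^{[k]}ΠΣ∧`, §5), `spspClass` (`Σ^{[k]}ΠΣΠ^{[δ]}`, §6), `swspClass` (`Σ∧ΣΠ^{[δ]}`, §6.1).
* Lemma 2.21 / §1 Remark 1 (`\overline{ΠΣ} = ΠΣ` [24, Prop. A.12], `\overline{ΠΣ∧} = ΠΣ∧`) ↦ FACTS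
  `DDS2021_lemma_2_21_piSigma`, `DDS2021_lemma_2_21`.
* Thm. 3.2 (= Thm. 1.1, de-bordering `Σ^{[k]}ΠΣ` into ABPs of size `s^{O(k·7^k)}`) ↦ FACT `DDS2021_thm_3_2`.
* Thm. 4.1 (= Thm. 1.2, `s^{O(k·7^k·log log s)}` hitting set), Thm. 4.3, Thm. 4.4 (= Thm. 1.3,
  log-variate) ↦ FACTS `DDS2021_thm_4_1`, `_thm_4_3`, `_thm_4_4`.
* Thm. 5.1 (de-bordering `Σ^{[k]}ΠΣ∧`) ↦ FACT `DDS2021_thm_5_1`; Thm. 6.6, Thm. 6.8 (border depth-4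
  hitting sets) ↦ FACTS `DDS2021_thm_6_6`, `DDS2021_thm_6_8`.

SIZE CONVENTION (disclosed rendering). The paper measures a depth-3/4 circuit by its graph size `s`
and states every bound as `s^{O(…)}` with an unspecified absolute constant. The typed statements
take the SYNTACTIC parameters of the normal forms (top fan-in `k`, product fan-in `d`, number of
variables `n`, exponent / sparsity bounds) and a budget `s ≥ 2` dominating them (`k, d, n, … ≤ s`);
since the printed circuit size of such a normal form is at most a fixed polynomial in `s`, each
printed bound `s_print^{O(g(k))}` implies the typed `s^{c·g(k)}` after enlarging the existential
constant `c` (and `s ≥ 2` absorbs leading constants). Hence every fact below is IMPLIED BY the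
printed statement (faithful up to this reparametrisation; never stronger).

EXPLICITNESS (disclosed weakening). The PIT theorems (4.1, 4.3, 4.4, 6.6, 6.8) assert EXPLICIT /
`T(s)`-time constructible hitting sets. Over an abstract field of characteristic zero the tree has no
cost model for points of `F^n` (the `ℚ`-encodings of `GKSS19HardnessToHittingSets.lean` are specific to
`ℚ`); the facts below keep the EXISTENCE of a hitting set of the printed SIZE (`|H| ≤ T(s)`, a
consequence of `T(s)`-time constructibility) and drop "explicit" — WEAKER than print, said per decl.

FIELD: "We … assume that it is of characteristic 0 … All our results hold for other fields … of
large characteristic" (§2, p0015, L411–413): typed for `CharZero F` only (the unquantified "large"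
is not typed).

## References

* [DuttaDwivediSaxena2022] P. Dutta, P. Dwivedi, N. Saxena, *Demystifying the border of depth-3
  algebraic circuits*, Proc. 62nd FOCS (2021), IEEE 2022, 92–103; full version held as
  `paper:galaxy-pdf-7641649743695546420` (§2 Def. 2.1 p0016 L416–419, Def. 2.5 p0017–p0018 L468–476,
  Lemma 2.21 p0024 L633–640; §3 Thm. 3.2 p0026; §4 Thm. 4.1 p0037 L974–976, Thm. 4.3 p0041
  L1098–1099, Thm. 4.4 p0043 L1131–1132; §5 Thm. 5.1 p0043 L1148–1150; §6 Thm. 6.6 p0047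
  L1248–1251, Thm. 6.8 p0048 L1270–1272).
* [MediniShpilka2021] (the `Σ^{[s]}Π^{[d]}Σ` normal form and the `F(ε)`-approximation predicate reused
  here); [ChatterjeeKumarSheVolk2022] (layered ABPs with a label-degree bound, for the bridge).
-/

noncomputable section

open MvPolynomial
open scoped BigOperators
namespace Literature.Computability.AlgebraicComplexity

namespace DDS2021

/-! ## §2: approximative closure, ABPs, and the syntactic classes -/
section Border

variable {F : Type*} [Field F] {n : ℕ}

/-- **DDS Def. 2.1 (approximative closure of a class)** (p0016:L3–6, L416–419): "Let `C_F` be a class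
of polynomials defined over a field `F`. Then `f(x) ∈ F[x_1,…,x_n]` is said to be in Approximative
Closure `C̄` if and only if there exists polynomial `Q ∈ F[ε, x]` such that
`g(x,ε) := f(x) + ε·Q(x,ε)` is in `C_{F(ε)}`." The class is supplied evaluated over
`F(ε) = RatFunc F` (`𝒞ε`), as in `MS2021.closure`; "`g = f + ε·Q`, `Q ∈ F[ε][x]`" is the tree's
`MS2021.IsEpsApprox f g` (same number of variables). [cite: DuttaDwivediSaxena2022, Def. 2.1 (full version p0016 L416–419)] -/
def border (𝒞ε : Set (MvPolynomial (Fin n) (RatFunc F))) : Set (MvPolynomial (Fin n) F) :=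
  {f | ∃ g ∈ 𝒞ε, MS2021.IsEpsApprox f g}

/-- Monotonicity of the approximative closure in the class. [cite: DuttaDwivediSaxena2022, Def. 2.1 (full version p0016 L416–419)] -/
theorem border_mono {𝒞ε 𝒟ε : Set (MvPolynomial (Fin n) (RatFunc F))} (h : 𝒞ε ⊆ 𝒟ε) :
    border 𝒞ε ⊆ border 𝒟ε := by
  rintro f ⟨g, hg, hfg⟩
  exact ⟨g, h hg, hfg⟩

end Border
section Classes

variable (K : Type*) [Field K] (n : ℕ)

/-- **`Σ^{[k]}Π^{[d]}Σ`** as a set of `n`-variate polynomials over `K`: sums of `k` products of `d`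
affine forms (DDS §1, p0006:L1: "these circuits compute polynomials of the form
`f = ∑_{i∈[k]} ∏_{j∈[d]} ℓ_{ij}` where `ℓ_{ij}` are linear polynomials"; fan-ins `≤ k`, `≤ d` by
padding with the forms `0`, `1`). The predicate is the tree's `MS2021.IsSPS`.
[cite: DuttaDwivediSaxena2022, §1.1 (full version p0006, L120–121)] -/
def spsClass (k d : ℕ) : Set (MvPolynomial (Fin n) K) :=
  {f | MS2021.IsSPS k d f}

/-- **`Σ∧Σ` (depth-3 diagonal circuits)** with top fan-in `≤ t` and exponents `≤ e`:
`f = ∑_{i<t} c_i · ℓ_i^{e_i}`, `ℓ_i` affine, `e_i ≤ e` (DDS §1 p0005 L112 "depth-3 diagonal circuits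
(`Σ∧Σ`), i.e. polynomials of the form `∑_i ℓ_i^{e_i}`"; §2.3 p0020). The printed size of such a
circuit is `Θ(∑_i (e_i + n))`; see the module docstring (SIZE CONVENTION).
[cite: DuttaDwivediSaxena2022, §2.3 (full version p0020, L537–540)] -/
def swsClass (t e : ℕ) : Set (MvPolynomial (Fin n) K) :=
  {f | ∃ (c : Fin t → K) (α : Fin t → Option (Fin n) → K) (ex : Fin t → ℕ), (∀ i, ex i ≤ e) ∧
    f = ∑ i, C (c i) * (C (α i none) + ∑ m, C (α i (some m)) * X m) ^ ex i}

/-- **`Σ^{[k]}ΠΣ∧`** (DDS §1 p0007 L152–153, §5: "when the bottom `Π` is replaced by `∧`"): sums of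
`k` products of `d` sums of UNIVARIATE polynomials of degree `≤ e`,
`f = ∑_{i<k} ∏_{j<d} (c_{ij} + ∑_m p_{ijm}(x_m))`. [cite: DuttaDwivediSaxena2022, §5 Thm. 5.1 (full version p0043, L1144–1150)] -/
def spswClass (k d e : ℕ) : Set (MvPolynomial (Fin n) K) :=
  {f | ∃ (c : Fin k → Fin d → K) (p : Fin k → Fin d → Fin n → Polynomial K),
    (∀ i j m, (p i j m).natDegree ≤ e) ∧
      f = ∑ i, ∏ j, (C (c i j) + ∑ m, Polynomial.aeval (X m : MvPolynomial (Fin n) K) (p i j m))}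

/-- **`Σ^{[k]}ΠΣΠ^{[δ]}`** (DDS §1 p0007 L149–151: "Polynomials computed by `Σ^{[k]}ΠΣΠ^{[δ]}` circuits
are of the form `f = ∑_{i∈[k]} ∏_j g_{ij}` where `deg(g_{ij}) ≤ δ`"): sums of `k` products of `d`
polynomials of total degree `≤ δ` with at most `m` monomials each (the sparsity `m` is the size
parameter of the bottom `ΣΠ^{[δ]}` part). [cite: DuttaDwivediSaxena2022, §1.1 and §6.2 (full version p0007 L149–151, p0048 L1265–1269)] -/
def spspClass (k d δ m : ℕ) : Set (MvPolynomial (Fin n) K) :=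
  {f | ∃ g : Fin k → Fin d → MvPolynomial (Fin n) K,
    (∀ i j, (g i j).totalDegree ≤ δ ∧ (g i j).support.card ≤ m) ∧ f = ∑ i, ∏ j, g i j}

/-- **`Σ∧ΣΠ^{[δ]}`** (DDS §6.1, Thm. 6.6: "polynomials approximated by `Σ∧ΣΠ^{[δ]}` circuits"): sums
of `t` powers `c_i · g_i^{e_i}`, `e_i ≤ e`, of polynomials `g_i` of total degree `≤ δ` with at most
`m` monomials each. [cite: DuttaDwivediSaxena2022, §6.1 Thm. 6.6 (full version p0047, L1248–1251)] -/
def swspClass (t e δ m : ℕ) : Set (MvPolynomial (Fin n) K) :=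
  {f | ∃ (c : Fin t → K) (g : Fin t → MvPolynomial (Fin n) K) (ex : Fin t → ℕ),
    (∀ i, ex i ≤ e ∧ (g i).totalDegree ≤ δ ∧ (g i).support.card ≤ m) ∧
      f = ∑ i, C (c i) * g i ^ ex i}

end Classes

/-! ### Exact members are border members (non-vacuity of `border`) -/

section Exact

variable {F : Type*} [Field F] {n : ℕ}

/-- A polynomial over `F`, read over `F(ε)` through the constants, approximates itself:
`g := f = f + ε·0` ("evidently, `\overline{size}(f) ≤ size(f)`", §1 p0004 L66).
[cite: DuttaDwivediSaxena2022, §1 (full version p0004, L66)] -/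
theorem isEpsApprox_map_algebraMap (f : MvPolynomial (Fin n) F) :
    MS2021.IsEpsApprox f (map (algebraMap F (RatFunc F)) f) := by
  refine ⟨le_rfl, fun e => ⟨Polynomial.C (coeff e f), ?_, ?_⟩⟩
  · rw [coeff_map, RatFunc.algebraMap_C]
    rfl
  · rw [Polynomial.coeff_C_zero]
    have h : (Fin.castLE (le_refl n) : Fin n → Fin n) = id := by
      funext i; simp
    rw [h, rename_id]
    rfl

/-- The `Σ^{[k]}Π^{[d]}Σ` normal form is preserved by extension of scalars (the class `C_F` read
over a larger field, as in Def. 2.1's `C_{F(ε)}`). [cite: DuttaDwivediSaxena2022, Def. 2.1 (full version p0016 L416–419)] -/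
theorem isSPS_map {K L : Type*} [Field K] [Field L] (φ : K →+* L) {k d : ℕ}
    {f : MvPolynomial (Fin n) K} (hf : MS2021.IsSPS k d f) :
    MS2021.IsSPS k d (map φ f) := by
  obtain ⟨α, rfl⟩ := hf
  refine ⟨fun i j o => φ (α i j o), ?_⟩
  simp only [map_sum, map_prod, map_add, map_mul, map_C, map_X]

/-- **`Σ^{[k]}Π^{[d]}Σ ⊆ \overline{Σ^{[k]}Π^{[d]}Σ}`** ("evidently, `\overline{size}(f) ≤ size(f)`",
§1 p0004 L66): an exact depth-3 representation over `F` is one over `F(ε)` approximating `f`.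
[cite: DuttaDwivediSaxena2022, §1 (full version p0004, L66)] -/
theorem mem_border_spsClass_of_isSPS {k d : ℕ} {f : MvPolynomial (Fin n) F}
    (hf : MS2021.IsSPS k d f) : f ∈ border (spsClass (RatFunc F) n k d) :=
  ⟨map (algebraMap F (RatFunc F)) f, isSPS_map _ hf, isEpsApprox_map_algebraMap f⟩

end Exact

/-! ### Def. 2.5: algebraic branching programs with univariate edge labels -/

section ABP

variable {F : Type*} [CommSemiring F] {n : ℕ}

/-- **DDS Def. 2.5 (ABP) with its size bound** (p0017 L468 – p0018 L476): "ABP is a computational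
model which is described using a layered graph with a source vertex `s` and a sink vertex `t`. All
edges connect vertices from layer `i` to `i+1`. Further, edges are labelled by univariate
polynomials. The polynomial computed by the ABP is `f = ∑_{path γ : s ⇝ t} wt(γ)` … The size (`s`)
of an ABP is the sum of the graph-size and the degree of the univariate polynomials that label."
RENDERING (as in the tree's `LayeredABPComputes` / `LayeredABPDegComputes`): vertex set `Fin V`,
a layer function, the label matrix `N` (every nonzero label goes up exactly one layer), computed
polynomial `(N ^ (layer t − layer s)) s t` (= the sum over `s–t` paths of the products of labels);
"univariate" = at most one variable occurs in the label (`vars.card ≤ 1`, constants allowed).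
`UABPComputes S f`: some such ABP with at most `S` vertices and all label degrees `≤ S` computes `f`
— implied by "an ABP of size `≤ S`" in the printed sense (graph-size `≤ S` and each degree `≤ S`).
[cite: DuttaDwivediSaxena2022, Def. 2.5 (full version p0017 L468 – p0018 L476)] -/
def UABPComputes (S : ℕ) (f : MvPolynomial (Fin n) F) : Prop :=
  ∃ (V : ℕ) (_ : V ≤ S) (layer : Fin V → ℕ) (s t : Fin V)
    (N : Matrix (Fin V) (Fin V) (MvPolynomial (Fin n) F)),
    (∀ u v, N u v ≠ 0 → layer v = layer u + 1) ∧
      (∀ u v, (N u v).vars.card ≤ 1 ∧ (N u v).totalDegree ≤ S) ∧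
        (N ^ (layer t - layer s)) s t = f

/-- Monotonicity of the ABP budget (Def. 2.5's size is an upper bound). [cite: DuttaDwivediSaxena2022, Def. 2.5 (full version p0018 L474–476)] -/
theorem UABPComputes.mono {S S' : ℕ} (h : S ≤ S') {f : MvPolynomial (Fin n) F}
    (hf : UABPComputes S f) : UABPComputes S' f := by
  obtain ⟨V, hV, layer, s, t, N, h1, h2, h3⟩ := hf
  exact ⟨V, hV.trans h, layer, s, t, N, h1, fun u v => ⟨(h2 u v).1, (h2 u v).2.trans h⟩, h3⟩

/-- **Bridge to the tree's layered ABPs** (`CKSV22GeneralABPLowerBound.LayeredABPDegComputes`): a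
DDS ABP within budget `S` is a layered ABP on `≤ S` vertices with edge labels of degree `≤ S`
(univariate labels are a special case of bounded-degree labels). [cite: ChatterjeeKumarSheVolk2022, Definition 1 and §1.1 "Edge labels"] -/
theorem UABPComputes.layeredABPDegComputes {S : ℕ} {f : MvPolynomial (Fin n) F}
    (hf : UABPComputes S f) : LayeredABPDegComputes S S f := by
  obtain ⟨V, hV, layer, s, t, N, h1, h2, h3⟩ := hf
  exact ⟨V, hV, layer, s, t, N, h1, fun u v => (h2 u v).2, h3⟩

end ABP

end DDS2021

open DDS2021 HittingSets

/-! ## §2.5: the constructive de-bordering facts quoted by DDS -/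

/-- NAMED FACT (**DDS §1.1 Remark 1 / proof of Thm. 3.2, `k = 1`** — p0006 L140–141: "When `k = 1`, it
is easy to show that `\overline{ΠΣ} = ΠΣ` [24, Prop. A.12] (see Lemma 2.21)"; p0026: "The `k = 1` case
is obvious, as `\overline{ΠΣ} = ΠΣ`"): a polynomial approximated by a product of `d` affine forms over
`F(ε)` is a product of `d` affine forms over `F`. A published, refereed statement quoted from
[24, Prop. A.12] of DDS's bibliography; not proved in the tree (it is the Zariski-closedness of the
set of products of affine forms; the paper's standing characteristic-`0` hypothesis is kept). -- FACT [cite: DuttaDwivediSaxena2022, §1.1 Remark 1 and §3 proof of Thm. 3.2 (full version p0006 L140–141, p0026 L716)] -/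
def DDS2021_lemma_2_21_piSigma : Prop :=
  ∀ (F : Type) [Field F] [CharZero F] (n d : ℕ) (f : MvPolynomial (Fin n) F),
    f ∈ border (spsClass (RatFunc F) n 1 d) → f ∈ spsClass F n 1 d

/-- NAMED FACT (**DDS Lemma 2.21 (De-bordering `ΠΣ∧`)**, p0024 L633–636): "Consider a polynomial
`f ∈ F[x]` which is approximated by `ΠΣ∧` of size `s` over `F(ε)[x]`. Then there exists a `ΠΣ∧` (hence
an ARO) of size `s` which exactly computes `f(x)`." Typed on the normal form `spswClass … 1 d e`
(one product of `d` sums of univariates of degree `≤ e`): border membership implies membership with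
the SAME parameters (the "(hence an ARO)" gloss is not typed). -- FACT
[cite: DuttaDwivediSaxena2022, Lemma 2.21 (full version p0024, L633–640)] -/
def DDS2021_lemma_2_21 : Prop :=
  ∀ (F : Type) [Field F] [CharZero F] (n d e : ℕ) (f : MvPolynomial (Fin n) F),
    f ∈ border (spswClass (RatFunc F) n 1 d e) → f ∈ spswClass F n 1 d e

/-! ## §3: de-bordering `Σ^{[k]}ΠΣ` (Thm. 3.2 = Thm. 1.1) -/

/-- NAMED FACT (**DDS Thm. 3.2 (De-bordering `Σ^{[k]}ΠΣ`) = Thm. 1.1**, p0026 L713–715): "Let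
`f(x) ∈ F[x_1,…,x_n]`, such that `f` can be computed by a `\overline{Σ^{[k]}ΠΣ}`-circuit of size `s`.
Then `f` is also computable by an ABP (over `F`), of size `s^{O(k·7^k)}`." (`F` of characteristic
`0`, §2.) Rendering (module docstring, SIZE CONVENTION): one absolute constant `c`; for every budget
`s ≥ 2` dominating the syntactic parameters (`1 ≤ k ≤ s`, `d ≤ s`, `n ≤ s`) of a `Σ^{[k]}Π^{[d]}Σ`
circuit over `F(ε)` approximating `f`, an ABP with univariate labels within budget `s^{c·k·7^k}`
computes `f` exactly. Implied by the printed statement (the printed size of such a circuit is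
`≤ s^3`; enlarge the constant). -- FACT (the DiDIL induction, §3; `k = 1` is `DDS2021_lemma_2_21_piSigma`).
[cite: DuttaDwivediSaxena2022, Thm. 3.2 (full version p0026, L713–715); Thm. 1.1 (p0006)] -/
def DDS2021_thm_3_2 : Prop :=
  ∃ c : ℕ, ∀ (F : Type) [Field F] [CharZero F] (n k d s : ℕ) (f : MvPolynomial (Fin n) F),
    1 ≤ k → k ≤ s → d ≤ s → n ≤ s → 2 ≤ s →
      f ∈ border (spsClass (RatFunc F) n k d) → UABPComputes (s ^ (c * k * 7 ^ k)) f

/-- Thm. 3.2 in the tree's layered-ABP vocabulary: the same budget bounds the number of vertices and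
the label degrees of a `LayeredABPDegComputes` witness (by `UABPComputes.layeredABPDegComputes`).
[cite: DuttaDwivediSaxena2022, Thm. 3.2 (full version p0026, L713–715)] -/
theorem DDS2021_thm_3_2.layeredABPDegComputes (h : DDS2021_thm_3_2) :
    ∃ c : ℕ, ∀ (F : Type) [Field F] [CharZero F] (n k d s : ℕ) (f : MvPolynomial (Fin n) F),
      1 ≤ k → k ≤ s → d ≤ s → n ≤ s → 2 ≤ s →
        f ∈ border (spsClass (RatFunc F) n k d) →
          LayeredABPDegComputes (s ^ (c * k * 7 ^ k)) (s ^ (c * k * 7 ^ k)) f := by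
  obtain ⟨c, hc⟩ := h
  exact ⟨c, fun F _ _ n k d s f hk hks hds hns hs hf => (hc F n k d s f hk hks hds hns hs hf).layeredABPDegComputes⟩

/-! ## §4: black-box PIT for the border classes (Thm. 4.1 = Thm. 1.2; Thms. 4.3, 4.4 = Thm. 1.3) -/

/-- NAMED FACT (**DDS Thm. 4.1 (Hitting set for `\overline{Σ^{[k]}ΠΣ}`) = Thm. 1.2**, p0037 L974–976):
"There exists an explicit `s^{O(k·7^k·log log s)}`-time hitting set for `\overline{Σ^{[k]}ΠΣ}`-circuits
of size `s`. For constant `k`, the algorithm runs in quasi-polynomial time." Rendering: for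
`n`-variate polynomials over a field `F` of characteristic `0` approximated by `Σ^{[k]}Π^{[d]}Σ`
circuits within budget `s` (`1 ≤ k ≤ s`, any `d ≤ s`, `n ≤ s`, `s ≥ 2`) there is ONE hitting set
`H ⊆ F^n` for the whole budget-`s` class, with `|H| ≤ s^{c·k·7^k·(log₂ log₂ s + 1)}` (`+1` pads the degenerate `log log s = 0`).
WEAKER than print: "explicit / `T(s)`-time" is dropped (module docstring, EXPLICITNESS); the size
bound is what `T(s)`-time constructibility implies. -- FACT
[cite: DuttaDwivediSaxena2022, Thm. 4.1 (full version p0037, L974–976); Thm. 1.2 (p0009, L218–220)] -/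
def DDS2021_thm_4_1 : Prop :=
  ∃ c : ℕ, ∀ (F : Type) [Field F] [CharZero F] (n k s : ℕ),
    1 ≤ k → k ≤ s → n ≤ s → 2 ≤ s →
      ∃ H : Finset (Fin n → F),
        H.card ≤ s ^ (c * k * 7 ^ k * (Nat.log 2 (Nat.log 2 s) + 1)) ∧
          IsHittingSetFor (↑H : Set (Fin n → F))
            {f | ∃ d, d ≤ s ∧ f ∈ border (spsClass (RatFunc F) n k d)}

/-- NAMED FACT (**DDS Thm. 4.3 (Derandomizing log-variate `\overline{Σ∧Σ}`)**, p0041 L1098–1099):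
"There is a `poly(s)`-time hitting set for `n = O(log s)` variate `\overline{Σ∧Σ}`-circuits of size
`s`." Rendering: for every constant `C` of the `O(log s)` there is an exponent `c` such that for
`n ≤ C·log₂ s` (`s ≥ 2`) a hitting set of size `≤ s^c` exists for the border class of all `Σ∧Σ`
normal forms within budget `s` (top fan-in `t ≤ s`, exponents `≤ e ≤ s`). WEAKER than print (explicitness
dropped). -- FACT [cite: DuttaDwivediSaxena2022, Thm. 4.3 (full version p0041, L1098–1099)] -/
def DDS2021_thm_4_3 : Prop :=
  ∀ C : ℕ, ∃ c : ℕ, ∀ (F : Type) [Field F] [CharZero F] (n s : ℕ),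
    2 ≤ s → n ≤ C * Nat.log 2 s →
      ∃ H : Finset (Fin n → F),
        H.card ≤ s ^ c ∧
          IsHittingSetFor (↑H : Set (Fin n → F))
            {f | ∃ t e, t ≤ s ∧ e ≤ s ∧ f ∈ border (swsClass (RatFunc F) n t e)}

/-- NAMED FACT (**DDS Thm. 4.4 (Efficient hitting set for log-variate `\overline{Σ^{[k]}ΠΣ}`) = Thm. 1.3**,
p0043 L1131–1132): "There exists an explicit `s^{O(k7^k)}`-time hitting set for `n = O(log s)`
variate, size-`s`, `\overline{Σ^{[k]}ΠΣ}` circuits." (Thm. 1.3, p0010 L248–250: "for constant `k`" a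
`poly(s)`-time hitting set.) Rendering: for every constant `C` of the `O(log s)` one exponent
constant `c`; `n ≤ C·log₂ s`, `1 ≤ k ≤ s`, `s ≥ 2`; one hitting set of size `≤ s^{c·k·7^k}` for the
border class of all `Σ^{[k]}Π^{[d]}Σ`, `d ≤ s`. WEAKER than print (explicitness dropped). -- FACT
[cite: DuttaDwivediSaxena2022, Thm. 4.4 (full version p0043, L1131–1132); Thm. 1.3 (p0010, L248–250)] -/
def DDS2021_thm_4_4 : Prop :=
  ∀ C : ℕ, ∃ c : ℕ, ∀ (F : Type) [Field F] [CharZero F] (n k s : ℕ),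
    1 ≤ k → k ≤ s → 2 ≤ s → n ≤ C * Nat.log 2 s →
      ∃ H : Finset (Fin n → F),
        H.card ≤ s ^ (c * k * 7 ^ k) ∧
          IsHittingSetFor (↑H : Set (Fin n → F))
            {f | ∃ d, d ≤ s ∧ f ∈ border (spsClass (RatFunc F) n k d)}

/-! ## §5: de-bordering `Σ^{[k]}ΠΣ∧` (Thm. 5.1) -/

/-- NAMED FACT (**DDS Thm. 5.1 (`\overline{Σ^{[k]}ΠΣ∧}` upper bound)**, p0043 L1148–1150): "Let
`f(x) ∈ F[x_1,…,x_n]`, such that `f` can be computed by a `\overline{Σ^{[k]}ΠΣ∧}`-circuit of size `s`.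
Then `f` is also computable by an ABP (over `F`), of size `s^{O(k·7^k)}`." Rendering as in
`DDS2021_thm_3_2`, with the `Σ^{[k]}ΠΣ∧` normal form `spswClass … k d e` (`1 ≤ k ≤ s`, `d, e, n ≤ s`,
`s ≥ 2`). The source marks the proof as a sketch ("we sketch the proof in Theorem 5.1", §1.1).
-- FACT [cite: DuttaDwivediSaxena2022, Thm. 5.1 (full version p0043, L1148–1150)] -/
def DDS2021_thm_5_1 : Prop :=
  ∃ c : ℕ, ∀ (F : Type) [Field F] [CharZero F] (n k d e s : ℕ) (f : MvPolynomial (Fin n) F),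
    1 ≤ k → k ≤ s → d ≤ s → e ≤ s → n ≤ s → 2 ≤ s →
      f ∈ border (spswClass (RatFunc F) n k d e) → UABPComputes (s ^ (c * k * 7 ^ k)) f

/-! ## §6: border depth-4 PIT (Thm. 6.6, Thm. 6.8) -/

/-- NAMED FACT (**DDS Thm. 6.6 (Hitting set for `\overline{Σ∧ΣΠ^{[δ]}}`)**, p0047 L1248–1251): "For the
class of `n`-variate, degree `d` polynomials approximated by `Σ∧ΣΠ^{[δ]}` circuits of size `s`, there
is an explicit hitting set `H ⊆ F^n` of size `s^{O(δ log s)}` i.e., for every such nonzero polynomial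
`f` there exists an `α ∈ H` for which `f(α) ≠ 0`." Rendering: normal form `swspClass … t e δ m`
(one hitting set for all top fan-ins `t`, exponent bounds `e`, bottom sparsities `m` within budget
`s`; `δ ≤ s`, `n ≤ s`, `s ≥ 2`; the degree `d ≤ e·δ` is then polynomial in `s`, as the printed
count `(nd)^{O(δ log s)} = s^{O(δ log s)}` requires), bound `s^{c·(δ+1)·(log₂ s + 1)}` (paddings only
enlarge the printed `s^{O(δ log s)}`). WEAKER than print (explicitness dropped). -- FACT
[cite: DuttaDwivediSaxena2022, Thm. 6.6 (full version p0047, L1248–1251)] -/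
def DDS2021_thm_6_6 : Prop :=
  ∃ c : ℕ, ∀ (F : Type) [Field F] [CharZero F] (n δ s : ℕ),
    δ ≤ s → n ≤ s → 2 ≤ s →
      ∃ H : Finset (Fin n → F),
        H.card ≤ s ^ (c * (δ + 1) * (Nat.log 2 s + 1)) ∧
          IsHittingSetFor (↑H : Set (Fin n → F))
            {f | ∃ t e m, t ≤ s ∧ e ≤ s ∧ m ≤ s ∧ f ∈ border (swspClass (RatFunc F) n t e δ m)}

/-- NAMED FACT (**DDS Thm. 6.8 (Hitting set for bounded border depth-4)**, p0048 L1270–1272): "There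
exists an explicit `s^{O(k·7^k·log log s)}` (respectively `s^{O(δ²k7^k log s)}`)-time hitting set for
`\overline{Σ^{[k]}ΠΣ∧}` (respectively `\overline{Σ^{[k]}ΠΣΠ^{[δ]}}`)-circuits of size `s`." Two clauses,
rendered on the normal forms `spswClass … k d e` and `spspClass … k d δ m` within budget `s`
(`1 ≤ k ≤ s`, `δ ≤ s`, `n ≤ s`, `s ≥ 2`; one hitting set for all `d, e, m ≤ s`), bounds `s^{c·k·7^k·(log₂log₂ s + 1)}`
resp. `s^{c·(δ+1)²·k·7^k·(log₂ s + 1)}`. WEAKER than print (explicitness dropped; the proof is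
printed as a sketch, §6.2). -- FACT [cite: DuttaDwivediSaxena2022, Thm. 6.8 (full version p0048, L1270–1272)] -/
def DDS2021_thm_6_8 : Prop :=
  (∃ c : ℕ, ∀ (F : Type) [Field F] [CharZero F] (n k s : ℕ),
    1 ≤ k → k ≤ s → n ≤ s → 2 ≤ s →
      ∃ H : Finset (Fin n → F),
        H.card ≤ s ^ (c * k * 7 ^ k * (Nat.log 2 (Nat.log 2 s) + 1)) ∧
          IsHittingSetFor (↑H : Set (Fin n → F))
            {f | ∃ d e, d ≤ s ∧ e ≤ s ∧ f ∈ border (spswClass (RatFunc F) n k d e)}) ∧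
  (∃ c : ℕ, ∀ (F : Type) [Field F] [CharZero F] (n k δ s : ℕ),
    1 ≤ k → k ≤ s → δ ≤ s → n ≤ s → 2 ≤ s →
      ∃ H : Finset (Fin n → F),
        H.card ≤ s ^ (c * (δ + 1) ^ 2 * k * 7 ^ k * (Nat.log 2 s + 1)) ∧
          IsHittingSetFor (↑H : Set (Fin n → F))
            {f | ∃ d m, d ≤ s ∧ m ≤ s ∧ f ∈ border (spspClass (RatFunc F) n k d δ m)})

/-! ## Shape check: a hitting set for the border class hits the exact class -/
/-- The border class of Thm. 4.1 contains the exact class `Σ^{[k]}Π^{[d]}Σ` (`d ≤ s`), so a hitting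
set as in Thm. 4.1 also hits exact depth-3 circuits — the remark "as `H` will also 'hit' polynomials
of class `C`" (§1.2, p0008 L180–181). [cite: DuttaDwivediSaxena2022, §1.2 (full version p0008, L180–181)] -/
theorem isHittingSetFor_spsClass_of_border {F : Type} [Field F] {n k s : ℕ} {H : Set (Fin n → F)}
    (hH : IsHittingSetFor H {f | ∃ d, d ≤ s ∧ f ∈ border (spsClass (RatFunc F) n k d)}) {d : ℕ}
    (hd : d ≤ s) : IsHittingSetFor H (spsClass F n k d) :=
  fun f hf hf0 => hH f ⟨d, hd, mem_border_spsClass_of_isSPS hf⟩ hf0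

end Literature.Computability.AlgebraicComplexity

end
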